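import Summits.HodgeConjecture.HodgeConjecture.Theses.NikulinTwinTransport

/-!
# Route NikulinTwinTransport — `EEightTwoSimilitude` (item stmt-HodgeConjecture-13436)

The lattice core of the completed Nikulin 2-similitude, decided on Mathlib's `CartanMatrix.E₈`
(Bourbaki numbering, plate VII: `α₁ = ½(e₁ + e₈) − ½(e₂ + ⋯ + e₇)`, `α₂ = e₁ + e₂`,
`α₃ = e₂ − e₁`, …, `α₈ = e₇ − e₆` in the standard model `E₈ = D₈ ∪ (D₈ + ½𝟙) ⊂ ℝ⁸`).

* Conjunct (1), an `A₁⁸` frame with 2-divisible sum: the columns of `R` are the simple-root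
  coordinates of the eight pairwise orthogonal roots `e₁ ± e₂, e₃ ± e₄, e₅ ± e₆, e₇ ± e₈`, so
  `Rᵀ E₈ R = 2·1`, and their sum is `2(e₁ + e₃ + e₅ + e₇)` with `e₁ + e₃ + e₅ + e₇ ∈ D₈ ⊂ E₈`,
  whose coordinates are `w = (0,2,1,3,2,2,1,1)`, so `R·𝟙 = 2w` (the "even eight" of
  van Geemen–Sarti §1 / Morrison §5).
* Conjunct (2), `E₈(2) ↪ E₈`: the columns of `M` are the coordinates of the images of the simple
  roots under the multiplier-2 similitude `(x₁,x₂,x₃,x₄,…) ↦ (x₁+x₂, x₁−x₂, x₃+x₄, x₃−x₄, …)` of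
  `ℝ⁸`, which maps `E₈` into `D₈ ⊂ E₈`; hence `Mᵀ E₈ M = 2·E₈` (index `2⁴ = 16`).

All three identities are closed by `decide` (kernel evaluation of 8 × 8 integer matrix products,
the same idiom as Mathlib's `CartanMatrix.E₈_transpose`); the witnesses were checked in exact
integer arithmetic beforehand.
-/

namespace Summit.HodgeConjecture.HodgeConjecture.Theorems

open Summit.HodgeConjecture.HodgeConjecture.Theses.NikulinTwinTransport

/-- **`EEightTwoSimilitude`** (item stmt-HodgeConjecture-13436 of route NikulinTwinTransport):
(1) `E₈` contains an `A₁⁸` frame — eight pairwise orthogonal roots (the columns of an integer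
matrix `R` with `Rᵀ E₈ R = 2·1`) whose sum is 2-divisible in the lattice (`R·𝟙 = 2w`); and
(2) `E₈(2)` embeds in `E₈` (an integer matrix `M` with `Mᵀ E₈ M = 2·E₈`).  Explicit witnesses in
the Bourbaki simple-root basis of `CartanMatrix.E₈`: `R` = coordinates of `e₁ ± e₂, …, e₇ ± e₈`,
`w` = coordinates of `e₁ + e₃ + e₅ + e₇`, `M` = matrix of the Hadamard-block 2-similitude
`(x₁,x₂,…) ↦ (x₁+x₂, x₁−x₂, …)`; each identity by `decide`. -/
theorem eEightTwoSimilitude_proof : EEightTwoSimilitude := by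
  unfold EEightTwoSimilitude
  refine ⟨⟨!![0, 0, 0, 0, 0, 0, 2, -2;
              1, 0, 1, 0, 1, 0, 3, -2;
              0, -1, 1, 0, 1, 0, 4, -3;
              0, 0, 2, 0, 2, 0, 6, -4;
              0, 0, 1, -1, 2, 0, 5, -3;
              0, 0, 0, 0, 2, 0, 4, -2;
              0, 0, 0, 0, 1, -1, 3, -1;
              0, 0, 0, 0, 0, 0, 2, 0], by decide, ![0, 2, 1, 3, 2, 2, 1, 1], by decide⟩,
          !![-2, 0, 0, 0, 0, 0, 0, 2;
             -3, 1, -1, 1, -1, 1, -1, 3;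
             -4, -1, -1, 2, -1, 1, -1, 4;
             -7, 0, 0, 2, -2, 2, -2, 6;
             -5, 0, 0, 1, -2, 3, -2, 5;
             -4, 0, 0, 0, 0, 2, -2, 4;
             -2, 0, 0, 0, 0, 1, -2, 4;
             -1, 0, 0, 0, 0, 0, 0, 2], by decide⟩

end Summit.HodgeConjecture.HodgeConjecture.Theorems
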